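import Summits.CriticalPhenomena.CardyFormulaZ2.Theses.CardyQContinuation
import Literature.Probability.RandomPlanarGeometry.PolygonLeftInterior
import Literature.Probability.RandomPlanarGeometry.JordanIndexOne

/-!
# The inside of a positively oriented design polygon is on the left of every edge
(route CardyQContinuation, serves stmt-CriticalPhenomena-5560, registered stub
`stub_design_leftInterior` of the n = 0 bridge of the crux `IsingJetsConformal`)

In the n = 0 bridge of the crux the conformal rectangles `Rp` compared with the Chelkak–Smirnov
discrete quadrilaterals are presented as insides `polygonDomain l h` of simple closed rectilinear
polygons, with boundary loop `polygonLoop l ∘ ρ` (`ρ` an increasing reparametrisation of the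
circle) and POSITIVE orientation, `Rp.index z = 1` on the inside (`JordanIndex.lean`). The
discrete construction (`stub_design_meshQuad`) needs the elementary local form of this
orientation: the inside lies immediately to the LEFT of every edge, i.e. for an interior point
`q = polygonLoop l ((k + θ)/N)` of edge `k` (`θ ∈ (0, 1)`, direction `v = l[(k+1) % N] - l[k]`),
`q + s · I v ∈ Rp` for all small `s > 0`.

* `stub_design_leftInterior` — the registered stub: the index of `polygonDomain l h` agrees
  with the index of `Rp`, whose boundary loop is `polygonLoop l ∘ ρ` with `ρ (s + 1) = ρ s + 1`
  (`JordanDomain.index_eq_mul_index` with degree `1`), so the polygonal domain is positively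
  oriented, and `eventually_mem_polygonDomain_add_normal`
  (`Literature/Probability/RandomPlanarGeometry/PolygonLeftInterior.lean`: the winding number of
  the polygon jumps by `+1` from the right to the left of an edge, and takes only the values `0`
  outside and `1` inside) puts `q + s I v` inside.

No new mathematics. [folklore]
-/

namespace Summit.CriticalPhenomena.CardyFormulaZ2.Theorems.CardyQContinuation

open Literature.Probability.RandomPlanarGeometry Set Filter Topology

/-- **Registered stub `stub_design_leftInterior`.** For a conformal rectangle `Rp` presented as
the inside of a simple closed (rectilinear) polygon `l`, with boundary loop `polygonLoop l ∘ ρ`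
(`ρ` a continuous increasing surjective lift of a circle map of degree `1`) and positive
orientation (`Rp.index z = 1` on `Rp`), the inside lies immediately to the left of every edge:
for `k < N`, `θ ∈ (0, 1)` and all small `s > 0`,
`polygonLoop l ((k + θ)/N) + s · I (l[(k+1) % N] - l[k]) ∈ Rp`. (Rectilinearity, monotonicity
and surjectivity of `ρ` are part of the registered signature but not used.) [folklore] -/
theorem stub_design_leftInterior :
    (∀ (Rp : Literature.Probability.RandomPlanarGeometry.ConformalRectangle) (l : List ℂ) (h : Literature.Probability.RandomPlanarGeometry.IsSimpleClosedPolygon l) (ρ : ℝ → ℝ), (∀ (k : ℕ) (hk : k < l.length), (l[k]).re = (l[(k + 1) % l.length]'(Nat.mod_lt _ h.pos)).re ∨ (l[k]).im = (l[(k + 1) % l.length]'(Nat.mod_lt _ h.pos)).im) → Continuous ρ → StrictMono ρ → Function.Surjective ρ → (∀ s : ℝ, ρ (s + 1) = ρ s + 1) → Rp.boundary = Literature.Probability.RandomPlanarGeometry.polygonLoop l ∘ ρ → Rp.carrier = (Literature.Probability.RandomPlanarGeometry.polygonDomain l h).carrier → (∀ z ∈ Rp.carrier, Rp.toJordanDomain.index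 z = 1) → (∀ (k : ℕ) (hk : k < l.length) (θ : ℝ), θ ∈ Set.Ioo (0 : ℝ) 1 → ∀ᶠ s : ℝ in nhdsWithin (0 : ℝ) (Set.Ioi 0), Literature.Probability.RandomPlanarGeometry.polygonLoop l ((k + θ) / l.length) + (s : ℂ) * (Complex.I * (l[(k + 1) % l.length]'(Nat.mod_lt _ h.pos) - l[k])) ∈ Rp.carrier)) := by
  intro Rp l h ρ _ hρc _ _ hρ1 hbd hcar hidx k hk θ hθ
  rw [hcar]
  refine eventually_mem_polygonDomain_add_normal h (fun z hz ↦ ?_) hk hθ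
  -- the polygonal domain is positively oriented: its boundary loop lifts through `Rp.boundary`
  -- with degree `1` (`JordanDomain.index_eq_mul_index`)
  have hzf : z ∉ frontier (polygonDomain l h).carrier := fun hf ↦
    Set.disjoint_left.1 (polygonDomain l h).disjoint_carrier_frontier hz hf
  have key := JordanDomain.index_eq_mul_index Rp.toJordanDomain (polygonDomain l h) (σ := ρ)
    hρc.continuousOn (fun t _ ↦ by rw [hbd, polygonDomain_boundary]; rfl) (n := 1)
    (by simpa using hρ1 0) hzf
  rw [hidx z (by rw [hcar]; exact hz)] at key
  simpa using key.symm

end Summit.CriticalPhenomena.CardyFormulaZ2.Theorems.CardyQContinuation
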